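import Mathlib
import HarnessLib
import HarnessLib.Audit
import Summits.BirchSwinnertonDyer.Statement
import Literature.NumberTheory.EllipticCurves.LeadingTermPPartRankLeOne
import Literature.NumberTheory.EllipticCurves.LeadingTerm
import Literature.NumberTheory.EllipticCurves.BSDSelmer
import Literature.NumberTheory.EllipticCurves.Selmer
import Literature.NumberTheory.EllipticCurves.SelmerCorankHolds
import Literature.NumberTheory.EllipticCurves.MordellWeil
import Literature.NumberTheory.EllipticCurves.AnalyticRank
import Literature.NumberTheory.EllipticCurves.CuspFormLFunction
import HarnessLib.Audit.Status.Attr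

/-!
Route: CompanionSqueezeDoorRankTwo

# Route CompanionSqueezeDoorRankTwo — a Selmer companion's exact L-value squeezes a rank-2 twist to
Sel_p = p^2, opening the rank-2 Sha[p]=0 door

It suffices to show X = SUPPLY ∧ PRINT-PACK ∧ KERNEL for the route-local LEAF T =
InfinitelyManyRankTwoShaPTrivial (a rank-2 DOOR in
the sense of S0-DOORS N4 (D): at one prime p >= 5, infinitely many elliptic E/Q, by minimal
discriminant, with rank E(Q) = 2 exactly,
Ш(E)[p] = 0, corank Ш[p^∞] = 0, corank Sel_p^∞ = 2 = rank and analytic rank >= 2). The leaf is NOT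
BSD and no class theorem at rank >= 2
is claimed; the deciding theorem `closes` concludes the leaf (director rung ruling requested,
precedent CountingDoorF2AtThree). SUPPLY
(CompanionSqueezeSupply, the open crux): infinitely many SQUEEZE PAIRS (W1, W2) at one p >= 5 —
equal p-Selmer cardinalities (in print: a
Mazur–Rubin p-Selmer companion pair twisted by one d), rank W1 >= 2 by points, and a partner W2 with
L(W2,1) ≠ 0, good at p, surjective
mod-p image, no rational p-torsion and v_p(L(W2,1)/Ω · #tors² / Tam) <= 2. PRINT-PACK
(PublishedInputsCompanion): Kato's rank-0 bound on the
order of Ш in Wuthrich's form, Gross–Zagier–Kolyvagin, modularity — named tree facts. KERNEL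
(CompanionSqueezeKernel, support): descent bookkeeping.
Lean: `∃ (p : ℕ) (_ : Fact p.Prime), 5 ≤ p ∧ {Δ : ℚ | ∃ (W₁ W₂ : WeierstrassCurve ℚ) (_ :
W₁.IsElliptic) (_ : W₁.IsGloballyMinimal) (_ : W₂.IsElliptic) (_ : W₂.IsGloballyMinimal), W₁.Δ = Δ ∧
Nat.card (W₁.selmerGroup (p : ℤ)) = Nat.card (W₂.selmerGroup (p : ℤ)) ∧ 2 ≤ W₁.mordellWeilRank ∧
W₂.entireLFunction 1 ≠ 0 ∧ W₂.HasGoodReductionAtPrime p ∧ W₂.HasSurjectiveModNGaloisRep p ∧ (∀ P :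
W₂.toAffine.Point, (p : ℤ) • P = 0 → P = 0) ∧ ∃ q : ℚ, W₂.entireLFunction 1 / (W₂.realPeriodRat : ℂ)
= (q : ℂ) ∧ padicValRat p (q * (W₂.torsionOrder : ℚ) ^ 2 / (W₂.tamagawaProduct : ℚ)) ≤ 2}.Infinite ∧
(NumberTheory.EllipticCurves.Wuthrich2014_shaOrder_dvd_of_L_one_ne_zero ∧
NumberTheory.EllipticCurves.rank_eq_analyticRank_of_analyticRank_le_one ∧
NumberTheory.EllipticCurves.ModularForms.existsUnique_isNewformOf)`

## Assembly
Pure logic (sorry-free in Sketch.lean and glue.lean): the supply gives p and an infinite set of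
discriminants of rank->=2 members of
squeeze pairs; the kernel (fed the print pack) upgrades each member to the leaf's five conclusions;
`Set.Infinite.mono`. The deciding
theorem `closes : CompanionSqueezeSupply → PublishedInputsCompanion → CompanionSqueezeKernel →
InfinitelyManyRankTwoShaPTrivial`
concludes the LEAF, not `BirchSwinnertonDyer` (draft by design until the director's rung ruling /
--closes-target).

Rationale: WHY THIS LINE. NEW LEVER «the partner's Kato bound squeezes the rank-2 Selmer group»: for a p-Selmer
companion pair (Mazur–Rubin, MazurRubin2012 =
arXiv:1203.0620, Thm. 3.1 and the table of §1: 676B1 ~ 676E1 at p = 5, 1026N1 ~ 1026O1 at p = 7)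
every quadratic twist d gives
Sel_p(E^d) = Sel_p(F^d) inside H¹(Q, E[p]); when E^d has two independent points and F^d has L(F^d,1)
≠ 0, Kato's Euler system in
Wuthrich's form (Wuthrich2014 Prop. 21, tree fact `Wuthrich2014_shaOrder_dvd_of_L_one_ne_zero`)
bounds #Ш(F^d) by the p-part of the
CLASSICAL, exactly computable value L(F^d,1)/Ω·tors²/Tam; if that valuation is 2, then p² <= p^rank
· #Ш(E^d)[p] | #Sel_p(E^d)
= #Sel_p(F^d) = #Ш(F^d)[p] <= p², so rank E^d = 2 EXACTLY and Ш(E^d)[p] = 0 — the splitting of Sel_p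
into points and Ш that the
SelmerRankBarrier says no algorithm performs is forced from OUTSIDE the curve. Visibility theory
(CremonaMazur2000, Agashe2009 =
arXiv:0908.3823 Prop. 3.1) runs this congruence in the opposite direction (rank 2 of E explains p² |
#Ш_an(F)); the squeeze runs it
backwards: invisible ⇒ absent. Imported areas: Selmer companions / congruences of Galois modules
(arithmetic of twists), Euler systems at
analytic rank 0 (Kato), arithmetic statistics of twist families (Stewart–Top StewartTop1995 for rank
>= 2 supply). No p-adic L-function,
no p-adic height, no class group, no numerical derivative enters: the certificate per member is two
rational points plus one exact
rational number attached to ANOTHER curve. No listed route uses companions or visibility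
(DefiniteTheta: derived theta elements;
KolyvaginDepthDoor: level-raised Kolyvagin classes; CountingDoorF2AtThree / LambdaDoorKernel /
EisensteinCountDoorRankTwo: Iwasawa λ
counts; ShaPrimaryTransfer: same-curve descent at two primes; CongruentShaFreeCut /
MordellShaFreeCut: rank-1 converses).

RANKED CRUXES. #0 InfinitelyManyRankTwoShaPTrivial (target) — the route-local leaf T: ∃ prime p >= 5
such that the set of minimal discriminants of elliptic W/Q with rank W(Q) = 2, Ш(W)[p] = 0, corank_p
Ш = 0, corank Sel_p^∞ = 2 and analytic rank >= 2 is infinite (door (D) of S0-DOORS N4; a DOOR, not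
BSD, no leading-term clause). (why it might fail: believed (Delaunay/BKLPR heuristics: Ш(E)[p] = 0
for most rank-2 E at fixed p >= 5), but every certificate of Ш[p] = 0 at rank 2 in print is
per-curve (Stein–Wuthrich p-adic algorithms, Cremona tables); infinitely many certified members at
one p is what no instrument delivers today.) [MazurRubin2012, Wuthrich2014, Agashe2009,
doi:10.1090/S0025-5718-2012-02649-4]
#2 CompanionSqueezeSupply (crux) — SUPPLY — ∃ prime p >= 5 and infinitely many (by W1.Δ) pairs of
globally minimal elliptic W1, W2 over Q with #Sel_p(W1) = #Sel_p(W2), rank W1 >= 2, L(W2,1) ≠ 0, W2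
good at p with surjective mod-p representation and no rational p-torsion, and L(W2,1)/Ω_W2 = q
rational with v_p(q · #W2(Q)_tors² / ∏ c_ℓ(W2)) <= 2. In print the pairs are the twists (E^d, F^d)
of ONE Mazur–Rubin p-Selmer companion pair; the open content is that v_p = 2 (not >= 3) and L(F^d,1)
≠ 0 happen for infinitely many of the rank->=2 twists d. [difficulty: open-problem] (why it might
fail: rank-2 twists are a thin set (~X^(3/4)); non-vanishing and p-indivisibility of L(F^d,1) beyond
the forced p² is known for a positive proportion of ALL d (Ono–Skinner, Kriz–Li) but on no thin
subfamily; v_p >= 3 might track rank E^d >= 2 (not for |d| <= 1200: kit j293807, 0/33).)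
[MazurRubin2012, StewartTop1995, Agashe2009, arXiv:1806.04944, doi:10.1007/s002220050230]
#3 PublishedInputsCompanion (crux) — PRINT PACK (crux only in the gate's auto-crux sense: hypotheses
of `closes` the tree does not derive) — three named Literature facts: (i) Wuthrich 2014 Prop. 21
(Kato): L(E,1) ≠ 0 and Ш finite ⇒ C·(L(E,1)/Ω)·#tors²/Tam = m·#Ш with C a unit away from 2, additive
primes and non-surjective primes; (ii) Gross–Zagier–Kolyvagin: analytic rank <= 1 ⇒ rank = analytic
rank and Ш finite; (iii) modularity (existence and uniqueness of the newform), used for r_an = 0 ↔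
L(E,1) ≠ 0. [difficulty: L] (why it might fail: all three are theorems in print; the risk is TYPING
— the tree's normalisation of realPeriodRat (Ω vs Ω⁺, Manin constant inside C) could make (i) false
as stated for some minimal model (a refuter kills a mis-normalised fact, not the mathematics).)
[Wuthrich2014, Kato2004, GrossZagier1986, Kolyvagin1990, BreuilConradDiamondTaylor2001]
#9 CompanionSqueezeKernel (support) — SQUEEZE KERNEL — from the print pack: for p >= 5 and a squeeze
pair (W1, W2) of globally minimal elliptic curves, rank W1 = 2, Ш(W1)[p] = 0, corank_p Ш(W1) = 0,
corank Sel_p^∞(W1) = 2 and analytic rank W1 >= 2. Proof plan (L, bookkeeping over tree theorems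
exists_kummerMap_holds, map_torsionH1ToH1_selmerGroup_holds, finite_selmerGroup_holds,
module_finite_point_holds, realPeriodRat_pos_holds, selmerCorank_eq_mordellWeilRank_add_holds):
modularity + L(W2,1) ≠ 0 ⇒ r_an(W2) = 0 ⇒ (GZK) rank W2 = 0, Ш(W2) finite ⇒ (Wuthrich, C a p-unit
since p >= 5 is good and surjective) v_p(#Ш(W2)) <= 2; W2(Q) finite without p-torsion ⇒ Sel_p(W2) =
Ш(W2)[p], so #Sel_p(W2) <= p²; Kummer for W1: p^rank · #(tors/p) · #Ш(W1)[p] = #Sel_p(W1) =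
#Sel_p(W2) <= p² with rank >= 2 ⇒ rank = 2, Ш(W1)[p] = 0 ⇒ Ш(W1)[p^∞] = 0 ⇒ shaCorank = 0,
selmerCorank = 2; GZK contrapositive: r_an(W1) <= 1 would give rank <= 1. [difficulty: L]
[Wuthrich2014, Kato2004, GrossZagier1986, Kolyvagin1990]

TWO-LAYER PLAN. Foreseen split of the supply once the kernel closes (k = 2, depth 1, registered as
the BC3 birth skeleton): CompanionSqueezeSupply ⇐
ShapeFamilyAtFive (print modulo bookkeeping: the 5-companion twist family of 676B1 ~ 676E1 gives
infinitely many pairs with equal Sel_5,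
rank >= 2 by Stewart–Top/Mestre polynomial families, partner good at 5, surjective, no 5-torsion) →
PartnerValuationNotAvoided (the open
heart: along that family L(F^d,1) ≠ 0 with v_5 = 2 infinitely often) → CompanionSqueezeSupply. A
second split of the heart by method:
(a) explicit polynomial rank-2 subfamily d(t) (Mestre/Stewart–Top) + one-sided p-adic/modular-symbol
non-divisibility along t; (b) a
Kriz–Li-type congruence count of twists with v_p minimal intersected with a rank->=2 construction.

KILL CRITERIA. Refutation of CompanionSqueezeKernel as typed (a squeeze pair at p >= 5 whose
rank->=2 member has rank >= 3 or Ш[p] ≠ 0) means a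
print input is mis-typed — close `refuted:CompanionSqueezeKernel` only if the mathematics, not the
normalisation, fails; else restate.
Refutation of the supply at EVERY p (for each p only finitely many squeeze pairs) kills the line
outright. A theorem "v_p(#Ш_an(F^d)) >= 3
whenever rank E^d >= 2" for companion pairs would kill it. The leaf proved elsewhere (any rank-2
door with Ш[p] = 0 output) moots it.

NOT DECOMPOSED YET. The choice of companion pair and prime (5 vs 7), the polynomial rank-2
subfamily, the equidistribution/non-divisibility engine for
L(F^d,1) on a thin family, and the transfer of squeeze-pair conditions along isomorphisms to minimal
models — all layer-2, after the
kernel closes. The analytic-rank-exactly-2 and leading-term clauses are deliberately NOT in the leaf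
(NumericalVanishing / PAdicHeight).

CHEAPEST FALSIFIER. RUN (kit j293807, PARI, |d| <= 1200 fundamental, gcd(d, pN) = 1): pair 676b1 ~
676e1 (p = 5): 25 even twists with rank E^d >= 2 by
points; 17 have companion L(F^d,1) ≠ 0 and ALL 17 have S_an(F^d) ∈ {25, 225}, v_5 = 2 exactly (door
members d = 69, 133, 177, 213, 237,
249, 253, 313, 349, 397, 453, 489, 773, 817, 933, 993, 1069); the other 8 have both twists of rank
2. Pair 1026n1 ~ 1026o1 (p = 7): 30
rank->=2 twists, 16 with partner L(1) ≠ 0, ALL 16 with S_an ∈ {49, 441}, v_7 = 2 (d = 13, −31, −187,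
373, 389, 493, 545, 565, 577, −583,
−607, −611, −671, −943, −955, 1033). Consistency p² | S_an (visibility direction) 33/33; kill signal
(v_p >= 3 always) absent: 0/33.

NUMBERS. p = 5 pair (676B1, 676E1), p = 7 pair (1026N1, 1026O1), 4-companions (1242L1, 1242K1),
9-companions (6555D1, 6555E1) [MazurRubin2012 §1].
Rank->=2 twists |d| <= X of a fixed curve: >> X^(1/7)/log² X unconditionally (StewartTop1995 Thm.
1), conjecturally ~ X^(3/4).
Door members found |d| <= 1200: 17 (p = 5) + 16 (p = 7); smallest conductors 676·69² and 1026·13².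
Items at open: 5.

DEFINITION REQUESTS. None: selmerGroup, sha, shaCorank, selmerCorank, entireLFunction,
realPeriodRat, torsionOrder, tamagawaProduct,
HasSurjectiveModNGaloisRep, HasGoodReductionAtPrime exist in Literature.NumberTheory.EllipticCurves.
A twist/companion API
(E^d, "n-Selmer companion") is NOT requested: the crux is typed over abstract pairs with equal
Selmer cardinality.

Novelty: Searches (2026-08-27/28): `lit search "n-Selmer companion elliptic curves" --source all` (held:
arXiv:1203.0620 Mazur–Rubin,
arXiv:1806.04944 p^r-companion modular forms, arXiv:1610.01195 2-Selmer near-companions (Yu),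
doi:10.1007/s11139-025-01215-2 Sym²
companions — none applies companions to Ш-triviality or rank certification); `lit search "visibility
Shafarevich-Tate rank two congruent
curve Kato bound" --source all` ([corpus:paper:arxiv-0908.3823 p.5] Agashe Prop. 3.1: visibility +
Stein–Wuthrich/Kato give r² | BSD
order of the RANK-0 curve — the opposite direction; crossref: Ono 1997, Xiong–Zaharescu 2009
congruent-number Ш); `lit search --hybrid
"Selmer companion curves same Selmer group quadratic twists"` (textbooks only: silverman2009,
delbourgo2008, hida2000, coates1999);
`lit galaxy search "Selmer companion|visible elements|visibility of Shafarevich" --star all` (0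
relevant); `lean search` / `rg` in
Summits/BirchSwinnertonDyer for companion|visib (no route or theorem); `ledger negatives --problem
BirchSwinnertonDyer` (1, unrelated).
Nearest prior art found: [corpus:paper:arxiv-0908.3823 p.5] Agashe 2009 Prop. 3.1 and
CremonaMazur2000 (visibility: rank 2 of E ⇒
p² divides #Ш_an(F)); [corpus:paper:arxiv-1203.0620 p.3, p.6] Mazur–Rubin companions (Sel_p(E^χ) ≅
Sel_p(F^χ) for all χ; their open
questions concern classification, not BSD); Stein–Wuthrich 2013
(doi:10.1090/S0025-5718-2012-02649-4: per-curve Ш(E)[p] = 0 at rank 2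
via p-adic L-functions).
Delta: run visibilit  [refs: 10.1007/s11139-025-01215-2, 10.1090/S0025-5718-2012-02649-4:, 1203.0620, 1806.04944, 1610.01195, doi:10.1007/s11139-025-01215-2, paper:arxiv-0908.3823, paper:arxiv-1203.0620, doi:10.1090/S0025-5718-2012-02649-4, CremonaMazur2000]

Barriers (technique_class: selmer-companion, kato-rank-zero, arithmetic-statistics): - technique_class: selmer-companion, kato-rank-zero, arithmetic-statistics
- Literature.Barriers.BirchSwinnertonDyer.SelmerRankBarrier: evaded by construction — the line never
splits Sel_p(W1) internally: the rank lower bound is two POINTS (input) and the Selmer upper bound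
p² is imported from the PARTNER's L-value via Kato; equality forces Ш(W1)[p] = 0. This is the seat's
«non-equivalent criterion»: a criterion on W2 decides W1.
- Literature.Barriers.BirchSwinnertonDyer.EulerSystemBigImageBarrier: inside Kato's class but
discharged — the Euler-system bound is applied only to W2 at a prime p >= 5 of good reduction with
SURJECTIVE mod-p image (a hypothesis of each squeeze pair, true for all but finitely many twists of
a non-CM pair), exactly `katoBigImageHypothesis_of_forall_hasSurjectiveModNGaloisRep`'s regime;
nothing is claimed at Eisenstein or CM primes.
- Literature.Barriers.BirchSwinnertonDyer.NumericalVanishingBarrier: outside — the certificate is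
NON-vanishing of L(W2,1) and its exact rational value over Ω (modular symbols, decidable); no
vanishing or derivative of any L-function is certified; analytic rank >= 2 of W1 comes from GZK's
contrapositive, not numerics.
- Literature.Barriers.BirchSwinnertonDyer.PAdicHeightBarrier: not touched — no p-adic height, no
p-adic L-function, no leading term; the leaf has no ord_T or regulator clause.
- Literature.Barriers.BirchSwinnertonDyer.StringentKolyvaginCapsAtMax: outside — no Kolyvagin system
is run on the rank-2 curve; the o

History (route lifecycle, newest last):
- 2026-08-28T00:51:27Z · rev 1: restated CompanionSqueezeSupply (stmt-BirchSwinnertonDyer-23775) — re-type 23775 per critic idea-crit-5 (00:02Z): W2 tied to W1 by a G_Q-equivariant iso of p-torsion (MR Selmer companion); Sel-cardinality clause kept so kernel (planner-bsd-idea-4-g3-0)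
- 2026-08-28T00:57:42Z · rev 2: restated CompanionSqueezeSupplyR (stmt-BirchSwinnertonDyer-24274) — T1 r1 typing flag: fixed companion pair, all twists (W-62 (e)); BC7 CLEAN vs summit and vs leaf, BC2 C->S / C->leaf not closable (line4/bc_MR.lean); kernel 2377 (planner-bsd-idea-4-g3-0)
- 2026-08-28T00:58:49Z · rev 2: restated CompanionSqueezeSupplyR (stmt-BirchSwinnertonDyer-24274) — T1 r1 typing flag: fixed companion pair, all twists (W-62 (e)); BC7 CLEAN vs summit and vs leaf, BC2 C->S / C->leaf not closable (line4/bc_MR.lean); kernel 2377 (planner-bsd-idea-4-g3-0)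

sub-problem: BirchSwinnertonDyer · status: draft · opened planner-bsd-idea-4-g2-0 2026-08-27T23:46:09Z · rev 2 · ledger route-BirchSwinnertonDyer-CompanionSqueezeDoorRankTwo
GENERATED by the gate from the ledger (D-0016/17). Provers cite these decls: `theorem foo : Summit.BirchSwinnertonDyer.BirchSwinnertonDyer.Theses.CompanionSqueezeDoorRankTwo.<Decl> := …` in Summits/BirchSwinnertonDyer/BirchSwinnertonDyer/Theorems/<Name>.lean.
-/

namespace Summit.BirchSwinnertonDyer.BirchSwinnertonDyer.Theses.CompanionSqueezeDoorRankTwo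

open scoped BigOperators Topology Manifold Classical MeasureTheory ProbabilityTheory Matrix InnerProductSpace ComplexConjugate ContinuousMap
open Filter Set Function TopologicalSpace MeasureTheory

attribute [summit_statement] _root_.BirchSwinnertonDyer

open Literature

/-! Retired items kept as plain definitions (history; not obligations of this route): landed proofs / closed glue still name them. -/

/-- retired stmt-BirchSwinnertonDyer-23775 (replaced, gen None) — named by an active item. -/
def CompanionSqueezeSupply : Prop :=
  ∃ (p : ℕ) (_ : Fact p.Prime), 5 ≤ p ∧ {Δ : ℚ | ∃ (W₁ W₂ : WeierstrassCurve ℚ) (_ : W₁.IsElliptic) (_ : W₁.IsGloballyMinimal) (_ : W₂.IsElliptic) (_ : W₂.IsGloballyMinimal), W₁.Δ = Δ ∧ Nat.card (W₁.selmerGroup (p : ℤ)) = Nat.card (W₂.selmerGroup (p : ℤ)) ∧ 2 ≤ W₁.mordellWeilRank ∧ W₂.entireLFunction 1 ≠ 0 ∧ W₂.HasGoodReductionAtPrime p ∧ W₂.HasSurjectiveModNGaloisRep p ∧ (∀ P : W₂.toAffine.Point, (p : ℤ) • P = 0 → P = 0) ∧ ∃ q : ℚ, W₂.entireLFunction 1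 / (W₂.realPeriodRat : ℂ) = (q : ℂ) ∧ padicValRat p (q * (W₂.torsionOrder : ℚ) ^ 2 / (W₂.tamagawaProduct : ℚ)) ≤ 2}.Infinite

/-- item stmt-BirchSwinnertonDyer-23774 · target · rank 0 · open · by planner
why it might fail: believed (Delaunay/BKLPR heuristics: Ш(E)[p] = 0 for most rank-2 E at fixed p >= 5), but every certificate of Ш[p] = 0 at rank 2 in print is per-curve (Stein–Wuthrich p-adic algorithms, Cremona tables); infinitely many certified members at one p is what no instrument delivers today.
sources: MazurRubin2012, Wuthrich2014, Agashe2009, doi:10.1090/S0025-5718-2012-02649-4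
[target] the route-local leaf T: ∃ prime p >= 5 such that the set of minimal discriminants of
elliptic W/Q with rank W(Q) = 2, Ш(W)[p] = 0, corank_p Ш = 0, corank Sel_p^∞ = 2 and analytic rank
>= 2 is infinite (door (D) of S0-DOORS N4; a DOOR, not BSD, no leading-term clause). -/
@[route_item "route-BirchSwinnertonDyer-CompanionSqueezeDoorRankTwo"]
def InfinitelyManyRankTwoShaPTrivial : Prop :=
  ∃ (p : ℕ) (_ : Fact p.Prime), 5 ≤ p ∧ {Δ : ℚ | ∃ (W : WeierstrassCurve ℚ) (_ : W.IsElliptic) (_ : W.IsGloballyMinimal), W.Δ = Δ ∧ W.mordellWeilRank = 2 ∧ (∀ c ∈ W.sha, (p : ℤ) • c = 0 → c = 0) ∧ W.shaCorank p = 0 ∧ W.selmerCorank p = 2 ∧ 2 ≤ W.analyticRank}.Infinite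

/-- item stmt-BirchSwinnertonDyer-24283 · crux · rank 2 · open · by planner
why it might fail: rank-≥2 twists of E are thin (~X^(3/4)); L(F^d,1)≠0 with p-part of the BSD quotient exactly p² is known for a positive proportion of ALL d (Ono–Skinner, Kriz–Li) but on no thin subfamily; the fixed pair (E,F) removes the free auxiliary curve (T1 cert supply_of_one_fixed_partner).
sources: MazurRubin2012, arXiv:1203.0620, StewartTop1995, arXiv:1806.04944
[crux] SUPPLY in the Mazur–Rubin companion typing (W-62 (e), T1 r1 typing flag; arXiv:1203.0620 Def.
2): ∃ prime p ≥ 5 and a FIXED pair (E, F) of elliptic curves over ℚ with E[p] ≃ F[p] as G_ℚ-modules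
(explicit equivariant AddEquiv of geometric p-torsion) such that, over the squarefree d, infinitely
many (by W₁.Δ) globally minimal models (W₁, W₂) of the simultaneous quadratic twists (E^d, F^d)
satisfy: #Sel_p(W₁) = #Sel_p(W₂), rank W₁ ≥ 2, L(W₂,1) ≠ 0, W₂ good at p with surjective mod-p
representation and no rational p-torsion, and v_p(L(W₂,1)/Ω · #tors² / Tam) ≤ 2 (⇒ #Sel_p(E^d) = p²
by the kernel). One auxiliary curve can no longer serve every member: the pair is fixed and the
members are its twists. Open content: among the rank-≥2 twists d of E, infinitely many have L(F^d,1)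
≠ 0 with the p-part of the BSD quotient exactly p² (not ≥ p³); falsifier kit j293807 stays pointed
at the fixed pair. -/
@[route_item "route-BirchSwinnertonDyer-CompanionSqueezeDoorRankTwo", crux]
def CompanionSqueezeSupplyMR : Prop :=
  ∃ (p : ℕ) (_ : Fact p.Prime) (E F : WeierstrassCurve ℚ) (_ : E.IsElliptic) (_ : F.IsElliptic), 5 ≤ p ∧ (∃ e : E.geomTorsion (p : ℤ) ≃+ F.geomTorsion (p : ℤ), ∀ (σ : Field.absoluteGaloisGroup ℚ) (P : E.geomTorsion (p : ℤ)), e (σ • P) = σ • e P) ∧ {Δ : ℚ | ∃ (d : ℤ) (_ : Squarefree d) (W₁ W₂ : WeierstrassCurve ℚ) (_ : W₁.IsElliptic) (_ : W₁.IsGloballyMinimal) (_ : W₂.IsElliptic) (_ : W₂.IsGloballyMinimal), (∃ c : WeierstrassCurve.VariableChange ℚ, W₁ = c • E.quadraticTwist (d : ℚ)) ∧ (∃ c : WeierstrassCurve.VariableChange ℚ, W₂ = c • F.quadraticTwist (d : ℚ)) ∧ W₁.Δ = Δ ∧ Nat.card (W₁.selmerGroup (p : ℤ)) = Nat.card (W₂.selmerGroup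 (p : ℤ)) ∧ 2 ≤ W₁.mordellWeilRank ∧ W₂.entireLFunction 1 ≠ 0 ∧ W₂.HasGoodReductionAtPrime p ∧ W₂.HasSurjectiveModNGaloisRep p ∧ (∀ P : W₂.toAffine.Point, (p : ℤ) • P = 0 → P = 0) ∧ ∃ q : ℚ, W₂.entireLFunction 1 / (W₂.realPeriodRat : ℂ) = (q : ℂ) ∧ padicValRat p (q * (W₂.torsionOrder : ℚ) ^ 2 / (W₂.tamagawaProduct : ℚ)) ≤ 2}.Infinite

/-- item stmt-BirchSwinnertonDyer-23776 · crux · rank 3 · open · by planner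
why it might fail: all three are theorems in print; the risk is TYPING — the tree's normalisation of realPeriodRat (Ω vs Ω⁺, Manin constant inside C) could make (i) false as stated for some minimal model (a refuter kills a mis-normalised fact, not the mathematics).
sources: Wuthrich2014, Kato2004, GrossZagier1986, Kolyvagin1990, BreuilConradDiamondTaylor2001
[crux] PRINT PACK (crux only in the gate's auto-crux sense: hypotheses of `closes` the tree does not
derive) — three named Literature facts: (i) Wuthrich 2014 Prop. 21 (Kato): L(E,1) ≠ 0 and Ш finite ⇒
C·(L(E,1)/Ω)·#tors²/Tam = m·#Ш with C a unit away from 2, additive primes and non-surjective primes;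
(ii) Gross–Zagier–Kolyvagin: analytic rank <= 1 ⇒ rank = analytic rank and Ш finite; (iii)
modularity (existence and uniqueness of the newform), used for r_an = 0 ↔ L(E,1) ≠ 0. [difficulty:
L] -/
@[route_item "route-BirchSwinnertonDyer-CompanionSqueezeDoorRankTwo", crux]
def PublishedInputsCompanion : Prop :=
  NumberTheory.EllipticCurves.Wuthrich2014_shaOrder_dvd_of_L_one_ne_zero ∧ NumberTheory.EllipticCurves.rank_eq_analyticRank_of_analyticRank_le_one ∧ NumberTheory.EllipticCurves.ModularForms.existsUnique_isNewformOf

/-- item stmt-BirchSwinnertonDyer-23777 · support · rank 9 · closed · proved by Summit.BirchSwinnertonDyer.BirchSwinnertonDyer.Theorems.companionSqueezeKernel_proof (prover) · by planner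
sources: Wuthrich2014, Kato2004, GrossZagier1986, Kolyvagin1990
[support] SQUEEZE KERNEL — from the print pack: for p >= 5 and a squeeze pair (W1, W2) of globally
minimal elliptic curves, rank W1 = 2, Ш(W1)[p] = 0, corank_p Ш(W1) = 0, corank Sel_p^∞(W1) = 2 and
analytic rank W1 >= 2. Proof plan (L, bookkeeping over tree theorems exists_kummerMap_holds,
map_torsionH1ToH1_selmerGroup_holds, finite_selmerGroup_holds, module_finite_point_holds,
realPeriodRat_pos_holds, selmerCorank_eq_mordellWeilRank_add_holds): modularity + L(W2,1) ≠ 0 ⇒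
r_an(W2) = 0 ⇒ (GZK) rank W2 = 0, Ш(W2) finite ⇒ (Wuthrich, C a p-unit since p >= 5 is good and
surjective) v_p(#Ш(W2)) <= 2; W2(Q) finite without p-torsion ⇒ Sel_p(W2) = Ш(W2)[p], so #Sel_p(W2)
<= p²; Kummer for W1: p^rank · #(tors/p) · #Ш(W1)[p] = #Sel_p(W1) = #Sel_p(W2) <= p² with rank >= 2
⇒ rank = 2, Ш(W1)[p] = 0 ⇒ Ш(W1)[p^∞] = 0 ⇒ shaCorank = 0, selmerCorank = 2; GZK contrapositive:
r_an(W1) <= 1 would give rank <= 1. [difficulty: L] -/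
@[route_item "route-BirchSwinnertonDyer-CompanionSqueezeDoorRankTwo", crux]
def CompanionSqueezeKernel : Prop :=
  PublishedInputsCompanion → ∀ (p : ℕ) [Fact p.Prime], 5 ≤ p → ∀ (W₁ W₂ : WeierstrassCurve ℚ) [W₁.IsElliptic] [W₁.IsGloballyMinimal] [W₂.IsElliptic] [W₂.IsGloballyMinimal], (Nat.card (W₁.selmerGroup (p : ℤ)) = Nat.card (W₂.selmerGroup (p : ℤ)) ∧ 2 ≤ W₁.mordellWeilRank ∧ W₂.entireLFunction 1 ≠ 0 ∧ W₂.HasGoodReductionAtPrime p ∧ W₂.HasSurjectiveModNGaloisRep p ∧ (∀ P : W₂.toAffine.Point, (p : ℤ) • P = 0 → P = 0) ∧ ∃ q : ℚ, W₂.entireLFunction 1 / (W₂.realPeriodRat : ℂ) = (q : ℂ) ∧ padicValRat p (q * (W₂.torsionOrder : ℚ) ^ 2 / (W₂.tamagawaProduct : ℚ)) ≤ 2) → W₁.mordellWeilRank = 2 ∧ (∀ c ∈ W₁.sha, (p : ℤ) • c = 0 → c = 0) ∧ W₁.shaCorank p = 0 ∧ W₁.selmerCorank p = 2 ∧ 2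 ≤ W₁.analyticRank

-- `CompanionSqueezeKernel` holds: proved by `Summit.BirchSwinnertonDyer.BirchSwinnertonDyer.Theorems.companionSqueezeKernel_proof` (its module imports this route file, so no `_holds` link can be stated here).

/-- item stmt-BirchSwinnertonDyer-23778 · assembly · rank 1 · closed · proved by Summit.BirchSwinnertonDyer.BirchSwinnertonDyer.Theorems.companionSqueezeDoorRankTwo_assembly_proof (prover) · by planner
sources: MazurRubin2012, Wuthrich2014
[assembly] CompanionSqueezeSupply → PublishedInputsCompanion → CompanionSqueezeKernel →
InfinitelyManyRankTwoShaPTrivial (the leaf; the summit is not reached and not claimed). -/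
@[route_item "route-BirchSwinnertonDyer-CompanionSqueezeDoorRankTwo"]
def Assembly : Prop :=
  CompanionSqueezeSupply → PublishedInputsCompanion → CompanionSqueezeKernel → InfinitelyManyRankTwoShaPTrivial

-- `Assembly` holds: proved by `Summit.BirchSwinnertonDyer.BirchSwinnertonDyer.Theorems.companionSqueezeDoorRankTwo_assembly_proof` (its module imports this route file, so no `_holds` link can be stated here).

-- records of items no longer active in this route (dropped / restated):
-- earlier CompanionSqueezeSupply (stmt-BirchSwinnertonDyer-23775, replaced 2026-08-28T00:51:27Z -> stmt-BirchSwinnertonDyer-24274): retired by None — ∃ (p : ℕ) (_ : Fact p.Prime), 5 ≤ p ∧ {Δ : ℚ | ∃ (W₁ W₂ : WeierstrassCurve ℚ) (_ : W₁.IsElliptic) (_ : W₁.IsGloballyMinimal) (_ : W₂.IsElliptic) (_ : W₂.IsGloballyMinimal), W₁.Δ = Δ ∧ Nat.card (W₁.selmerGroup (p : ℤ)) = Nat.card (W₂.selmerGroup (p : ℤ)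
-- earlier CompanionSqueezeSupplyR (stmt-BirchSwinnertonDyer-24274, replaced 2026-08-28T00:58:49Z -> stmt-BirchSwinnertonDyer-24283): retired by None — ∃ (p : ℕ) (_ : Fact p.Prime), 5 ≤ p ∧ {Δ : ℚ | ∃ (W₁ W₂ : WeierstrassCurve ℚ) (_ : W₁.IsElliptic) (_ : W₁.IsGloballyMinimal) (_ : W₂.IsElliptic) (_ : W₂.IsGloballyMinimal), W₁.Δ = Δ ∧ (∃ e : W₁.geomTorsion (p : ℤ) ≃+ W₂.geomTorsion (p : ℤ), ∀ (σ : Fie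

/-! D-0027 §2.1 — DECIDING THEOREM (planner-authored via `route open/edit --closes-file`; by planner-bsd-idea-4-g3-0 2026-08-28T00:58:49Z):
its hypotheses are this route's items and its conclusion the sub-problem Statement (glue_lint), and it elaborates with this file. -/

@[closes "route-BirchSwinnertonDyer-CompanionSqueezeDoorRankTwo"] theorem closes (hS : CompanionSqueezeSupplyMR) (hIn : PublishedInputsCompanion)
    (hK : CompanionSqueezeKernel) : InfinitelyManyRankTwoShaPTrivial := by
  obtain ⟨p, hp, E, F, hE, hF, h5, _hiso, hInf⟩ := hS
  refine ⟨p, hp, h5, ?_⟩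
  refine Set.Infinite.mono ?_ hInf
  rintro Δ ⟨d, hd, W₁, W₂, h₁, h₁m, h₂, h₂m, _hc₁, _hc₂, hΔ, hpair⟩
  obtain ⟨hr, hsha, hco, hsel, han⟩ := hK hIn p h5 W₁ W₂ hpair
  exact ⟨W₁, h₁, h₁m, hΔ, hr, hsha, hco, hsel, han⟩

end Summit.BirchSwinnertonDyer.BirchSwinnertonDyer.Theses.CompanionSqueezeDoorRankTwo
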